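import Summits.HubbardSuperconductivity.HubbardSuperconductivity.Theorems.BalabanIRBirEveryGroundStateSourceShiftCore
import Summits.HubbardSuperconductivity.HubbardSuperconductivity.Theorems.BalabanIRBirEveryGroundStateThermalChord
import Literature.MathematicalPhysics.QuantumLattice.SectorSpectrum
import HarnessLib

/-!
# Route `BalabanIR`, crux 5 `BirEveryGroundState` (`stmt-HubbardSuperconductivity-2083`):
# EVERY ground state from the ground-state AVERAGE of the PENALISED model — the conjugate-source shift

The crux "average ⇒ every" is, as typed, engine-free glue over an unproved (and abstractly false)
genericity statement (`Theorems.birEveryGroundState_iff_transfer`, `Cruxes/BirEveryGroundState/Disproof.lean`).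
The companion `BalabanIRBirEveryGroundStateSourceShiftCore` proves the finite-dimensional fact that
removes the genericity bet while keeping the target's SHAPE (a ground-state-average trace
inequality): by the variational sandwich of the κ-chord, the ground-state AVERAGE of `Y` for the
PENALISED matrix `H + κY`, `κ > 0`, bounds `re ⟨ψ, Y ψ⟩` for EVERY ground state `ψ` of `H`
(`forall_ground_le_re_rayleigh_of_penalised_trace_le`). Here, on the Hubbard torus
(`H = hubbardTorus 2 L 1 U`, sector `S = (2⌊(1-δ)L²/2⌋, S^z = 0)`, `Y_L = L⁻⁴ Δ_d† Δ_d`, which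
preserves `S`):

* `penalisedGroundEigenspace_ne_bot` — `H + κ Y_L` has ground states in `S` (`sector_groundState`);
* `forall_groundState_bound_of_shiftedAverage` — if, eventually in even `L`, for SOME `κ_L > 0` the
  ground-state average of `Δ_d† Δ_d` over the sector ground eigenspace of `H + κ_L Y_L` is `≥ c L⁴`
  in the basis-free form of the target (`c L⁴ · re tr P_κ ≤ re tr (P_κ Δ_d† Δ_d)`: verbatim the matrix
  of `BirGroundStateAverageLRO` with `H` replaced by `H + κ_L Y_L`), then EVERY normalised sector
  ground state of `H` has `c L⁴ ≤ re ⟨ψ, Δ_d† Δ_d ψ⟩`;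
* `hasLRO_of_shiftedAverage` — hence the summit's every-ground-state `d_{x²-y²}` pair-field LRO at
  `(U, δ)` (`forall_hasLRO_iff_groundState_bound`);
* `birEveryGroundState_structural_of_shiftedAverage` — the item's body, verbatim and route-file-free,
  from "window average ⇒ shifted average at one coupling of the window" (socket);
* `hubbardSuperconductivity_of_shiftedAverage` / `shiftedAverageSummit` — THE RE-CUT: the shifted
  average at ONE `(δ, U)` gives the summit outright (no window, no crux 5).

Why the shift is the right repair (note for the planner). Varying the coupling `U` moves `H` by the
extensive, NON-conjugate term `U · D`, so nothing orders the ground multiplets and genericity had to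
be conjectured; varying the CONJUGATE source `κ Y_L` (an `O(κ)`-norm perturbation, `‖Y_L‖ = O(1)`)
orders them for free, by concavity of `κ ↦ E_S(H + κ Y_L)`. The Disproof's counterexample (a
pair-poor partner in a reducible ground multiplet) is treated correctly: the penalty makes the
pair-poor partner THE ground state of `H + κ Y_L`, so the shifted hypothesis fails there, as it must.
Physically the shifted hypothesis holds for `0 < κ < κ_c = ΔE_flow / y₀` only (pair-phase-twist
states are pair-dark at an `L`-independent energy `ΔE_flow ≈ 2π² ρ_s y₀` above `E₀`; card
`kappa-chord-transfer`), so `κ` must be small and FIXED — which `∃ κ_L > 0` allows — and the engine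
that proves the target for `H` is asked to prove the same average bound for `H + κ Y_L`. The thermal
(partition-function) currency is `Theorems.hasLRO_of_thermalChord` (`…ThermalChord`).

This module imports NO route file (rev-5 materialisation rule). Sources: R. B. Griffiths,
J. Math. Phys. 5 (1964) 1215 §III; Koma–Tasaki, J. Stat. Phys. 76 (1994) 745 §1; Scalapino,
Phys. Rep. 250 (1995) 329 §2; Lieb, PRL 62 (1989) 1201 (sectors); Tasaki (2020) §2.2, App. A.2.
Folklore; no definition is introduced.

## Mathlib / tree search

REUSED: `Theorems.forall_ground_le_re_rayleigh_of_penalised_trace_le` (`…SourceShiftCore`),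
`Theorems.forall_hasLRO_iff_groundState_bound`, `Theorems.birEveryGroundState_structural_of_transfer`
(`…Socket`), `Theorems.pairIntensity_mulVec_mem_szSector` (`…ThermalChord`),
`Literature.MathematicalPhysics.QuantumLattice.sector_groundState`, `mem_szSector_two_mul_zero_iff`,
`szSector_invariant_hubbardTorus`, `exists_unit_isGroundStateInSector_hubbardTorus`,
`natFloor_filling_le_sq`; Mathlib `Module.End.mem_eigenspace_iff`, `Matrix.mulVec_single_one`.
-/

noncomputable section

open scoped Matrix.Norms.L2Operator ComplexOrder MatrixOrder InnerProductSpace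

namespace Summit.HubbardSuperconductivity.HubbardSuperconductivity.Theorems

open Matrix Finset Filter Literature.MathematicalPhysics.QuantumLattice
open Literature.Probability.LatticeModels

/-! ### The Hubbard torus -/

section Hubbard

/-- **The penalised Hubbard Hamiltonian has sector ground states.** For every side `L ≥ 1`,
`δ ≥ -1`, `U, κ ∈ ℝ`: the ground eigenspace of `X = hubbardTorus 2 L 1 U + κ Y_L`
(`Y_L = L⁻⁴ Δ_d† Δ_d`) in the sector `S = (2⌊(1-δ)L²/2⌋, S^z = 0)` is nonzero. `S` is the
coordinate subspace of configurations with `⌊(1-δ)L²/2⌋` up and down electrons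
(`mem_szSector_two_mul_zero_iff`), it is inhabited (a ground state of `H` lives there), and `X` has
no matrix entries leaving it (`H` and `Δ_d† Δ_d` conserve `(N↑, N↓)`), so `sector_groundState`
applies. Lieb, PRL 62 (1989) 1201; Tasaki (2020) §2.2. [folklore] -/
theorem penalisedGroundEigenspace_ne_bot (L : ℕ) [NeZero L] (U δ : ℝ) (hδ : -1 ≤ δ) (κ : ℝ) :
    let N : ℕ := 2 * ⌊(1 - δ) * (L : ℝ) ^ 2 / 2⌋₊
    let H := hubbardTorus 2 L 1 U
    let S := szSector (Λ := FermionTorus 2 L) N 0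
    let Yd : Matrix (Finset (Orb (FermionTorus 2 L))) (Finset (Orb (FermionTorus 2 L))) ℂ :=
      ((1 : ℂ) / (L : ℂ) ^ 4) • ((pairField dWaveFormFactor L)ᴴ * pairField dWaveFormFactor L)
    S ⊓ Module.End.eigenspace (Matrix.toLin' (H + (κ : ℂ) • Yd))
        ((((H + (κ : ℂ) • Yd).minEnergyOn S : ℝ)) : ℂ) ≠ ⊥ := by
  classical
  intro N H S Yd
  set n₀ : ℕ := ⌊(1 - δ) * (L : ℝ) ^ 2 / 2⌋₊ with hn₀
  set X : Matrix (Finset (Orb (FermionTorus 2 L))) (Finset (Orb (FermionTorus 2 L))) ℂ :=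
    H + (κ : ℂ) • Yd with hX
  -- hermiticity
  have hH : H.IsHermitian := LiebThm1.hamiltonian_isHermitian (fermionTorusGraph 2 L) 1 U
  have hA : ((pairField dWaveFormFactor L)ᴴ * pairField dWaveFormFactor L).IsHermitian :=
    isHermitian_conjTranspose_mul_self _
  have hYd : Yd.IsHermitian := by
    refine hA.smul ?_
    rw [isSelfAdjoint_iff, Complex.star_def, map_div₀, map_one, map_pow, Complex.conj_natCast]
  have hXh : X.IsHermitian :=
    hH.add (hYd.smul (by rw [isSelfAdjoint_iff, Complex.star_def, Complex.conj_ofReal]))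
  -- invariance of the sector
  have hinvX : ∀ v ∈ S, X *ᵥ v ∈ S := by
    intro v hv
    rw [hX, add_mulVec, smul_mulVec, smul_mulVec]
    exact S.add_mem (szSector_invariant_hubbardTorus 2 L 1 U _ hv)
      (S.smul_mem _ (S.smul_mem _ (pairIntensity_mulVec_mem_szSector L _ hv)))
  -- coordinate description of the sector
  have hK : ∀ v, v ∈ S ↔ ∀ s, ¬((upPart s).card = n₀ ∧ (downPart s).card = n₀) → v s = 0 :=
    fun v => mem_szSector_two_mul_zero_iff n₀ v
  -- no matrix entries from the sector to its complement
  have hblock : ∀ i j : Finset (Orb (FermionTorus 2 L)),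
      ¬((upPart i).card = n₀ ∧ (downPart i).card = n₀) →
      ((upPart j).card = n₀ ∧ (downPart j).card = n₀) → X i j = 0 := by
    intro i j hi hj
    have hmem : (Pi.single j (1 : ℂ) : Fock (Orb (FermionTorus 2 L))) ∈ S := by
      refine (hK _).2 fun s hs => ?_
      by_cases hsj : s = j
      · exact absurd (hsj ▸ hj) hs
      · rw [Pi.single_apply, if_neg hsj]
    have h := (hK _).1 (hinvX _ hmem) i hi
    rwa [mulVec_single_one] at h
  -- the sector is inhabited (a ground state of `H` lives there)
  obtain ⟨ψ, -, hgs⟩ :=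
    Literature.Barriers.HubbardSuperconductivity.exists_unit_isGroundStateInSector_hubbardTorus U L
      n₀ (Literature.Barriers.HubbardSuperconductivity.natFloor_filling_le_sq hδ L)
  have hp : ∃ s : Finset (Orb (FermionTorus 2 L)), (upPart s).card = n₀ ∧ (downPart s).card = n₀ := by
    by_contra hnone
    exact hgs.2.1 (funext fun s => (hK ψ).1 hgs.1 s fun hs => hnone ⟨s, hs⟩)
  obtain ⟨⟨v, hvS, hv0, hXv⟩, -⟩ :=
    sector_groundState X hXh (fun s => (upPart s).card = n₀ ∧ (downPart s).card = n₀) hp hblock S hK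
  rw [Submodule.ne_bot_iff]
  refine ⟨v, Submodule.mem_inf.2 ⟨hvS, ?_⟩, hv0⟩
  rw [Module.End.mem_eigenspace_iff, Matrix.toLin'_apply]
  exact hXv

/-- **EVERY GROUND STATE FROM THE SHIFTED AVERAGE (one coupling).** Fix `U`, `δ ≥ -1`, `c` and
`L₀`. Suppose that at every even side `L ≥ L₀` there is SOME `κ > 0` such that the ground-state
AVERAGE of `Δ_d† Δ_d` over the sector ground eigenspace of the PENALISED Hamiltonian
`hubbardTorus 2 L 1 U + κ L⁻⁴ Δ_d† Δ_d` (sector `(2⌊(1-δ)L²/2⌋, S^z = 0)`) is at least `c L⁴`, in the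
basis-free form of the target: `c L⁴ · re tr P_κ ≤ re tr (P_κ Δ_d† Δ_d)`. Then every normalised sector
ground state `ψ` of the UNPENALISED `hubbardTorus 2 L 1 U` at every even `L ≥ L₀` has
`c L⁴ ≤ re ⟨ψ, Δ_d† Δ_d ψ⟩` (`forall_ground_le_re_rayleigh_of_penalised_trace_le` with `Y = Y_L`,
`penalisedGroundEigenspace_ne_bot`). Degeneracy-blind; no window of couplings; `κ` may depend on
`L`. Griffiths (1964) §III; Scalapino, Phys. Rep. 250 (1995) §2. [folklore] -/
theorem forall_groundState_bound_of_shiftedAverage (U δ : ℝ) (hδ : -1 ≤ δ) (c : ℝ) (L₀ : ℕ)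
    (h : ∀ (L : ℕ) [NeZero L], L₀ ≤ L → Even L → ∃ κ : ℝ, 0 < κ ∧
      let N : ℕ := 2 * ⌊(1 - δ) * (L : ℝ) ^ 2 / 2⌋₊
      let H := hubbardTorus 2 L 1 U
      let S := szSector (Λ := FermionTorus 2 L) N 0
      let Yd : Matrix (Finset (Orb (FermionTorus 2 L))) (Finset (Orb (FermionTorus 2 L))) ℂ :=
        ((1 : ℂ) / (L : ℂ) ^ 4) • ((pairField dWaveFormFactor L)ᴴ * pairField dWaveFormFactor L)
      let E := S ⊓ Module.End.eigenspace (Matrix.toLin' (H + (κ : ℂ) • Yd))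
        ((((H + (κ : ℂ) • Yd).minEnergyOn S : ℝ)) : ℂ)
      let P := projMatrix (E.map (Fock.toEuclidean (ι := Orb (FermionTorus 2 L)) :
        Fock (Orb (FermionTorus 2 L)) →ₗ[ℂ] EuclideanSpace ℂ (Finset (Orb (FermionTorus 2 L)))))
      c * (L : ℝ) ^ 4 * P.trace.re ≤
        (P * ((pairField dWaveFormFactor L)ᴴ * pairField dWaveFormFactor L)).trace.re) :
    ∀ (L : ℕ) [NeZero L], L₀ ≤ L → Even L → ∀ ψ : Fock (Orb (FermionTorus 2 L)),
      IsGroundStateInSector (hubbardTorus 2 L 1 U) (2 * ⌊(1 - δ) * (L : ℝ) ^ 2 / 2⌋₊) 0 ψ →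
      star ψ ⬝ᵥ ψ = 1 →
      c * (L : ℝ) ^ 4 ≤
        (star ψ ⬝ᵥ ((pairField dWaveFormFactor L)ᴴ * pairField dWaveFormFactor L) *ᵥ ψ).re := by
  intro L _ hL hLe ψ hgs hψ
  obtain ⟨κ, hκ, hyp⟩ := h L hL hLe
  simp only at hyp
  have hE := penalisedGroundEigenspace_ne_bot L U δ hδ κ
  simp only at hE
  set A : Matrix (Finset (Orb (FermionTorus 2 L))) (Finset (Orb (FermionTorus 2 L))) ℂ :=
    (pairField dWaveFormFactor L)ᴴ * pairField dWaveFormFactor L with hA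
  set H := hubbardTorus 2 L 1 U with hH
  set S := szSector (Λ := FermionTorus 2 L) (2 * ⌊(1 - δ) * (L : ℝ) ^ 2 / 2⌋₊) 0 with hS
  set Yd : Matrix (Finset (Orb (FermionTorus 2 L))) (Finset (Orb (FermionTorus 2 L))) ℂ :=
    ((1 : ℂ) / (L : ℂ) ^ 4) • A with hYd
  set E := S ⊓ Module.End.eigenspace (Matrix.toLin' (H + (κ : ℂ) • Yd))
    ((((H + (κ : ℂ) • Yd).minEnergyOn S : ℝ)) : ℂ) with hEdef
  set P := projMatrix (E.map (Fock.toEuclidean (ι := Orb (FermionTorus 2 L)) :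
    Fock (Orb (FermionTorus 2 L)) →ₗ[ℂ] EuclideanSpace ℂ (Finset (Orb (FermionTorus 2 L)))))
    with hP
  have hL4 : (0 : ℝ) < (L : ℝ) ^ 4 := by
    have : (0 : ℝ) < (L : ℝ) := Nat.cast_pos.mpr (Nat.pos_of_ne_zero (NeZero.ne L))
    positivity
  have hcast : ((1 : ℂ) / (L : ℂ) ^ 4) = (((1 : ℝ) / (L : ℝ) ^ 4 : ℝ) : ℂ) := by push_cast; ring
  -- the hypothesis in the `Y_L`-normalisation: `c · re tr P ≤ re tr (P Y_L)`
  have htr : (P * Yd).trace.re = (P * A).trace.re / (L : ℝ) ^ 4 := by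
    rw [hYd, Matrix.mul_smul, trace_smul, smul_eq_mul, hcast, Complex.re_ofReal_mul]
    ring
  have hyp' : c * P.trace.re ≤ (P * Yd).trace.re := by
    rw [htr, le_div_iff₀ hL4]
    calc c * P.trace.re * (L : ℝ) ^ 4 = c * (L : ℝ) ^ 4 * P.trace.re := by ring
      _ ≤ (P * A).trace.re := hyp
  have key := forall_ground_le_re_rayleigh_of_penalised_trace_le H Yd S hκ c hE hyp' hgs.1 hψ
    hgs.2.2
  -- back to `Δ_d† Δ_d`
  have hexp : (star ψ ⬝ᵥ Yd *ᵥ ψ).re = (star ψ ⬝ᵥ A *ᵥ ψ).re / (L : ℝ) ^ 4 := by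
    rw [hYd, smul_mulVec, dotProduct_smul, smul_eq_mul, hcast, Complex.re_ofReal_mul]
    ring
  rw [hexp, le_div_iff₀ hL4] at key
  exact key

/-- **Shifted average ⇒ the summit's every-ground-state LRO at `(U, δ)`.** For `δ ≥ -1`: if at
coupling `U` there are `c > 0` and `L₀` such that at every even side `L ≥ L₀` some `κ > 0` carries
the ground-state-average bound `c L⁴ · re tr P_κ ≤ re tr (P_κ Δ_d† Δ_d)` for the PENALISED Hamiltonian
`hubbardTorus 2 L 1 U + κ L⁻⁴ Δ_d† Δ_d`, then EVERY admissible sequence of normalised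
`(2⌊(1-δ)L²/2⌋, S^z = 0)`-sector ground states of `hubbardTorus 2 L 1 U` has `d_{x²-y²}` pair-field
long-range order along the even sides (`forall_groundState_bound_of_shiftedAverage` +
`forall_hasLRO_iff_groundState_bound`). Griffiths (1964) §III; Scalapino (1995) §2. [folklore] -/
theorem hasLRO_of_shiftedAverage (U δ : ℝ) (hδ : -1 ≤ δ)
    (h : ∃ c : ℝ, 0 < c ∧ ∃ L₀ : ℕ, ∀ (L : ℕ) [NeZero L], L₀ ≤ L → Even L → ∃ κ : ℝ, 0 < κ ∧
      let N : ℕ := 2 * ⌊(1 - δ) * (L : ℝ) ^ 2 / 2⌋₊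
      let H := hubbardTorus 2 L 1 U
      let S := szSector (Λ := FermionTorus 2 L) N 0
      let Yd : Matrix (Finset (Orb (FermionTorus 2 L))) (Finset (Orb (FermionTorus 2 L))) ℂ :=
        ((1 : ℂ) / (L : ℂ) ^ 4) • ((pairField dWaveFormFactor L)ᴴ * pairField dWaveFormFactor L)
      let E := S ⊓ Module.End.eigenspace (Matrix.toLin' (H + (κ : ℂ) • Yd))
        ((((H + (κ : ℂ) • Yd).minEnergyOn S : ℝ)) : ℂ)
      let P := projMatrix (E.map (Fock.toEuclidean (ι := Orb (FermionTorus 2 L)) :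
        Fock (Orb (FermionTorus 2 L)) →ₗ[ℂ] EuclideanSpace ℂ (Finset (Orb (FermionTorus 2 L)))))
      c * (L : ℝ) ^ 4 * P.trace.re ≤
        (P * ((pairField dWaveFormFactor L)ᴴ * pairField dWaveFormFactor L)).trace.re) :
    ∀ (N : ℕ → ℕ) (ψ : ∀ L, Fock (Orb (FermionTorus 2 L))),
      (∀ L, Even L → N L = 2 * ⌊(1 - δ) * (L : ℝ) ^ 2 / 2⌋₊ ∧ star (ψ L) ⬝ᵥ ψ L = 1 ∧
        IsGroundStateInSector (hubbardTorus 2 L 1 U) (N L) 0 (ψ L)) →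
      HasLongRangeOrder (fun k => halfOpenBox 2 (2 * k))
        (fun k => torusPullback (pairFieldCorr dWaveFormFactor ψ) (2 * k)) := by
  obtain ⟨c, hc, L₀, hL₀⟩ := h
  exact (forall_hasLRO_iff_groundState_bound U δ hδ).2
    ⟨c, hc, L₀, forall_groundState_bound_of_shiftedAverage U δ hδ c L₀ hL₀⟩

/-- **The body of `Theses.BalabanIR.BirEveryGroundState` (item `stmt-HubbardSuperconductivity-2083`),
verbatim and route-file-free, from "window average ⇒ SHIFTED average at ONE coupling of the
window".** If for all data `(δ, U₁, U₂, c)` the ground-state-average hypothesis on the window yields a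
coupling `U ∈ (U₁, U₂)`, a constant `c' > 0` and a threshold beyond which, at every even side, some
`κ > 0` carries `c' L⁴ · re tr P_κ ≤ re tr (P_κ Δ_d† Δ_d)` for the penalised Hamiltonian
`hubbardTorus 2 L 1 U + κ L⁻⁴ Δ_d† Δ_d`, then the item holds (`forall_groundState_bound_of_shiftedAverage`
fed into the socket `birEveryGroundState_structural_of_transfer`). The hypothesis has the SAME shape
as the item's own hypothesis (a ground-state-average trace inequality), for the penalised model; no
genericity of ground multiplets is involved. Griffiths (1964) §III; Scalapino (1995) §2. [folklore] -/
theorem birEveryGroundState_structural_of_shiftedAverage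
    (h : ∀ (δ U₁ U₂ c : ℝ), δ ∈ Set.Ioo (0:ℝ) (1/2) → 0 < U₁ → U₁ < U₂ → 0 < c →
      (∀ U ∈ Set.Ioo U₁ U₂, ∃ L₀ : ℕ, ∀ (L : ℕ) [NeZero L], L₀ ≤ L → Even L →
        let N : ℕ := 2 * ⌊(1 - δ) * (L : ℝ) ^ 2 / 2⌋₊
        let H := hubbardTorus 2 L 1 U
        let S := szSector (Λ := FermionTorus 2 L) N 0
        let E₀ := S ⊓ Module.End.eigenspace (Matrix.toLin' H) ((H.minEnergyOn S : ℝ) : ℂ)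
        let P := projMatrix (E₀.map (Fock.toEuclidean (ι := Orb (FermionTorus 2 L)) :
          Fock (Orb (FermionTorus 2 L)) →ₗ[ℂ] EuclideanSpace ℂ (Finset (Orb (FermionTorus 2 L)))))
        c * (L : ℝ) ^ 4 * P.trace.re ≤
          (P * ((pairField dWaveFormFactor L)ᴴ * pairField dWaveFormFactor L)).trace.re) →
      ∃ U ∈ Set.Ioo U₁ U₂, ∃ c' : ℝ, 0 < c' ∧ ∃ L₀ : ℕ, ∀ (L : ℕ) [NeZero L], L₀ ≤ L → Even L →
        ∃ κ : ℝ, 0 < κ ∧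
        let N : ℕ := 2 * ⌊(1 - δ) * (L : ℝ) ^ 2 / 2⌋₊
        let H := hubbardTorus 2 L 1 U
        let S := szSector (Λ := FermionTorus 2 L) N 0
        let Yd : Matrix (Finset (Orb (FermionTorus 2 L))) (Finset (Orb (FermionTorus 2 L))) ℂ :=
          ((1 : ℂ) / (L : ℂ) ^ 4) • ((pairField dWaveFormFactor L)ᴴ * pairField dWaveFormFactor L)
        let E := S ⊓ Module.End.eigenspace (Matrix.toLin' (H + (κ : ℂ) • Yd))
          ((((H + (κ : ℂ) • Yd).minEnergyOn S : ℝ)) : ℂ)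
        let P := projMatrix (E.map (Fock.toEuclidean (ι := Orb (FermionTorus 2 L)) :
          Fock (Orb (FermionTorus 2 L)) →ₗ[ℂ] EuclideanSpace ℂ (Finset (Orb (FermionTorus 2 L)))))
        c' * (L : ℝ) ^ 4 * P.trace.re ≤
          (P * ((pairField dWaveFormFactor L)ᴴ * pairField dWaveFormFactor L)).trace.re) :
    ∀ (δ U₁ U₂ c : ℝ), δ ∈ Set.Ioo (0:ℝ) (1/2) → 0 < U₁ → U₁ < U₂ → 0 < c → (∀ U ∈ Set.Ioo U₁ U₂, ∃ L₀ : ℕ, ∀ (L : ℕ) [NeZero L], L₀ ≤ L → Even L → let N : ℕ := 2 * ⌊(1 - δ) * (L : ℝ) ^ 2 / 2⌋₊; let H := Literature.MathematicalPhysics.QuantumLattice.hubbardTorus 2 L 1 U; let S := Literature.MathematicalPhysics.QuantumLattice.szSector (Λ := Literature.MathematicalPhysics.QuantumLattice.FermionTorus 2 L) N 0; let E₀ := S ⊓ Module.End.eigenspace (Matrix.toLin' H) ((H.minEnergyOn S : ℝ) : ℂ); let P := Literature.MathematicalPhysics.QuantumLattice.projMatrix (E₀.map (Literature.MathematicalPhysics.QuantumLattice.Fock.toEuclidean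 (ι := Literature.MathematicalPhysics.QuantumLattice.Orb (Literature.MathematicalPhysics.QuantumLattice.FermionTorus 2 L)) : Literature.MathematicalPhysics.QuantumLattice.Fock (Literature.MathematicalPhysics.QuantumLattice.Orb (Literature.MathematicalPhysics.QuantumLattice.FermionTorus 2 L)) →ₗ[ℂ] EuclideanSpace ℂ (Finset (Literature.MathematicalPhysics.QuantumLattice.Orb (Literature.MathematicalPhysics.QuantumLattice.FermionTorus 2 L))))); c * (L : ℝ) ^ 4 * P.trace.re ≤ (P * (Matrix.conjTranspose (Literature.MathematicalPhysics.QuantumLattice.pairField Literature.MathematicalPhysics.QuantumLattice.dWaveFormFactor L) * Literature.MathematicalPhysics.QuantumLattice.pairField Literature.MathematicalPhysics.QuantumLattice.dWaveFormFactor L)).trace.re) → ∃ U ∈ Set.Ioo U₁ U₂, ∀ (N : ℕ → ℕ) (ψ : ∀ L, Literature.MathematicalPhysics.QuantumLattice.Fock (Literature.MathematicalPhysics.QuantumLattice.Orb (Literature.MathematicalPhysics.QuantumLattice.FermionTorus 2 L))), (∀ L, Even L → N L = 2 * ⌊(1 - δ) * (L : ℝ) ^ 2 / 2⌋₊ ∧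 star (ψ L) ⬝ᵥ ψ L = 1 ∧ Literature.MathematicalPhysics.QuantumLattice.IsGroundStateInSector (Literature.MathematicalPhysics.QuantumLattice.hubbardTorus 2 L 1 U) (N L) 0 (ψ L)) → Literature.Probability.LatticeModels.HasLongRangeOrder (fun k => Literature.Probability.LatticeModels.halfOpenBox 2 (2 * k)) (fun k => Literature.MathematicalPhysics.QuantumLattice.torusPullback (Literature.MathematicalPhysics.QuantumLattice.pairFieldCorr Literature.MathematicalPhysics.QuantumLattice.dWaveFormFactor ψ) (2 * k)) := by
  refine birEveryGroundState_structural_of_transfer fun δ U₁ U₂ c hδ hU₁ hU₁₂ hc hyp => ?_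
  obtain ⟨U, hU, c', hc', L₀, hL₀⟩ := h δ U₁ U₂ c hδ hU₁ hU₁₂ hc hyp
  exact ⟨U, hU, c', hc', L₀,
    forall_groundState_bound_of_shiftedAverage U δ (by linarith [hδ.1]) c' L₀ hL₀⟩

/-- **The re-cut this module suggests: the SHIFTED ground-state average at ONE `(δ, U)` gives the
summit.** If for some hole doping `δ ∈ (0, 1/2)` and some repulsion `U > 0` there are `c > 0` and `L₀`
such that at every even side `L ≥ L₀` some `κ > 0` carries the ground-state-average bound
`c L⁴ · re tr P_κ ≤ re tr (P_κ Δ_d† Δ_d)` for the PENALISED Hamiltonian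
`hubbardTorus 2 L 1 U + κ L⁻⁴ Δ_d† Δ_d` (sector `(2⌊(1-δ)L²/2⌋, S^z = 0)`), then
`HubbardSuperconductivity` holds (`hasLRO_of_shiftedAverage`). The hypothesis is the matrix of the
route's target `BirGroundStateAverageLRO` at one coupling, with the conjugate pair penalty switched
on; "every ground state" then costs nothing. Conditional on its hypothesis (nothing about the
Hubbard model is proved here). Griffiths (1964) §III; Scalapino (1995) §2. [folklore] -/
theorem hubbardSuperconductivity_of_shiftedAverage
    (h : ∃ δ ∈ Set.Ioo (0:ℝ) (1/2), ∃ U : ℝ, 0 < U ∧ ∃ c : ℝ, 0 < c ∧ ∃ L₀ : ℕ,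
      ∀ (L : ℕ) [NeZero L], L₀ ≤ L → Even L → ∃ κ : ℝ, 0 < κ ∧
      let N : ℕ := 2 * ⌊(1 - δ) * (L : ℝ) ^ 2 / 2⌋₊
      let H := hubbardTorus 2 L 1 U
      let S := szSector (Λ := FermionTorus 2 L) N 0
      let Yd : Matrix (Finset (Orb (FermionTorus 2 L))) (Finset (Orb (FermionTorus 2 L))) ℂ :=
        ((1 : ℂ) / (L : ℂ) ^ 4) • ((pairField dWaveFormFactor L)ᴴ * pairField dWaveFormFactor L)
      let E := S ⊓ Module.End.eigenspace (Matrix.toLin' (H + (κ : ℂ) • Yd))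
        ((((H + (κ : ℂ) • Yd).minEnergyOn S : ℝ)) : ℂ)
      let P := projMatrix (E.map (Fock.toEuclidean (ι := Orb (FermionTorus 2 L)) :
        Fock (Orb (FermionTorus 2 L)) →ₗ[ℂ] EuclideanSpace ℂ (Finset (Orb (FermionTorus 2 L)))))
      c * (L : ℝ) ^ 4 * P.trace.re ≤
        (P * ((pairField dWaveFormFactor L)ᴴ * pairField dWaveFormFactor L)).trace.re) :
    _root_.HubbardSuperconductivity := by
  obtain ⟨δ, hδ, U, hU, c, hc, L₀, hL₀⟩ := h
  show Literature.Hubbard.DWaveSuperconductivityHubbard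
  exact ⟨U, hU, δ, hδ, hasLRO_of_shiftedAverage U δ (by linarith [hδ.1]) ⟨c, hc, L₀, hL₀⟩⟩

/-- **Registered form** (sub-goal `shiftedAverageSummit` of item `stmt-HubbardSuperconductivity-2083`):
`hubbardSuperconductivity_of_shiftedAverage` as a closed implication. [folklore] -/
theorem shiftedAverageSummit : (∃ δ ∈ Set.Ioo (0:ℝ) (1/2), ∃ U : ℝ, 0 < U ∧ ∃ c : ℝ, 0 < c ∧ ∃ L₀ : ℕ, ∀ (L : ℕ) [NeZero L], L₀ ≤ L → Even L → ∃ κ : ℝ, 0 < κ ∧ let N : ℕ := 2 * ⌊(1 - δ) * (L : ℝ) ^ 2 / 2⌋₊; let H := Literature.MathematicalPhysics.QuantumLattice.hubbardTorus 2 L 1 U; let S := Literature.MathematicalPhysics.QuantumLattice.szSector (Λ := Literature.MathematicalPhysics.QuantumLattice.FermionTorus 2 L) N 0; let Yd : Matrix (Finset (Literature.MathematicalPhysics.QuantumLattice.Orb (Literature.MathematicalPhysics.QuantumLattice.FermionTorus 2 L))) (Finset (Literature.MathematicalPhysics.QuantumLattice.Orb (Literature.MathematicalPhysics.QuantumLattice.FermionTorus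 2 L))) ℂ := ((1 : ℂ) / (L : ℂ) ^ 4) • (Matrix.conjTranspose (Literature.MathematicalPhysics.QuantumLattice.pairField Literature.MathematicalPhysics.QuantumLattice.dWaveFormFactor L) * Literature.MathematicalPhysics.QuantumLattice.pairField Literature.MathematicalPhysics.QuantumLattice.dWaveFormFactor L); let E := S ⊓ Module.End.eigenspace (Matrix.toLin' (H + (κ : ℂ) • Yd)) ((((H + (κ : ℂ) • Yd).minEnergyOn S : ℝ)) : ℂ); let P := Literature.MathematicalPhysics.QuantumLattice.projMatrix (E.map (Literature.MathematicalPhysics.QuantumLattice.Fock.toEuclidean (ι := Literature.MathematicalPhysics.QuantumLattice.Orb (Literature.MathematicalPhysics.QuantumLattice.FermionTorus 2 L)) : Literature.MathematicalPhysics.QuantumLattice.Fock (Literature.MathematicalPhysics.QuantumLattice.Orb (Literature.MathematicalPhysics.QuantumLattice.FermionTorus 2 L)) →ₗ[ℂ] EuclideanSpace ℂ (Finset (Literature.MathematicalPhysics.QuantumLattice.Orb (Literature.MathematicalPhysics.QuantumLattice.FermionTorus 2 L))))); c * (L : ℝ) ^ 4 * P.trace.re ≤ (P * (Matrix.conjTranspose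 (Literature.MathematicalPhysics.QuantumLattice.pairField Literature.MathematicalPhysics.QuantumLattice.dWaveFormFactor L) * Literature.MathematicalPhysics.QuantumLattice.pairField Literature.MathematicalPhysics.QuantumLattice.dWaveFormFactor L)).trace.re) → HubbardSuperconductivity :=
  fun h => hubbardSuperconductivity_of_shiftedAverage h

end Hubbard

end Summit.HubbardSuperconductivity.HubbardSuperconductivity.Theorems
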